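import Mathlib
import Summits.NavierStokesRegularity.NavierStokesRegularity.Theorems.EulerZoomLiouvillePowerGaugeEulerLiouvilleSelfSimilarVorticalEscape
import Literature.Analysis.ODE.EvolutionMapHomeomorph
import Literature.Analysis.FluidPDE.VorticityCalculus

/-!
# THE INEFFECTIVE RESIDENCE CLOCK of a `C²` self-similar Euler profile (ROUND-39 (I), nsreg-p2 g33)

The consumer `NeedleRace.curl_eq_zero_of_powerClock_of_strongThinExits` (…NeedleClockThreshold) kills the vorticity of a
profile from STRONG THIN EXITS (plate t39d) plus a RESIDENCE CLOCK `hclock`: around every vortical point a blob at most half of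
whose labels keep their backward similarity orbit inside `B̄_{2R}` during the window `[0, c′R^e]`, for all large `R` and
every admissible cut-off copy of the profile.  This file proves the same statement with the QUANTIFIERS SOFTENED to
`∀ R > 0, ∃ L = L(R) < ∞` — the *ineffective clock* — for EVERY `C²` self-similar Euler profile with `0 < γ < ½`, with no
growth, pressure, far-field or symmetry hypothesis:

* `isClosed_lingerSet`: the set of labels whose backward orbit (of a `C¹` cut-off field with bounded gradient) stays in
  `B̄_M` during `[0, L]` is closed (continuity of `y ↦ Φ_{−σ} y`);
* `flow_neg_eq_of_agree`: CUT-OFF INDEPENDENCE — two cut-off fields that agree on `B̄_M` have the same backward orbits from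
  every label that lingers in `B̄_M` (ODE uniqueness), hence the same linger sets;
* `ineffectiveClock`: `curl U x₀ ≠ 0` ⇒ `∃ r > 0, ∀ R > 0, ∃ L ≥ 0`, for every `C¹` cut-off `V` (`‖DV‖ ≤ K`, `V = U` on a ball
  `⊃ B̄_{2R}`): `vol(B(x₀,r) ∩ {y : ∀ σ ∈ [0,L], ‖Φ^V_{−σ} y‖ ≤ 2R}) ≤ vol(B(x₀,r))/2`.

Proof of the last: the linger sets of the canonical cut-off decrease in `L` to a subset of the vortical confined set, which
is NULL by `Loc.volume_vortical_confined_eq_zero` (…SelfSimilarVorticalEscape); measure continuity from above; cut-off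
independence.  Hence the whole gap between the tree and the general `C²` needle of THE ONE STATEMENT is the RATE `L(R)`:
the kill needs `L(R) ≤ c′R^{2+ρ}` with `6γc′ < β` (ROUND-39 §1 (S), the sandwich).  Not NS, not E. [folklore]
-/

open Set Filter Topology Metric Function MeasureTheory InnerProductSpace
open scoped RealInnerProductSpace NNReal ENNReal

set_option linter.dupNamespace false

namespace Summit.NavierStokesRegularity.NavierStokesRegularity.Theorems.PowerGaugeEulerLiouville.NeedleClock

open Literature.Analysis Literature.Analysis.FluidPDE
open Summit.NavierStokesRegularity.NavierStokesRegularity.Theorems.PowerGaugeEulerLiouville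

variable {γ : ℝ} {U V V₁ V₂ : EuclideanSpace ℝ (Fin 3) → EuclideanSpace ℝ (Fin 3)} {P : EuclideanSpace ℝ (Fin 3) → ℝ}

/-- The LINGER SET `{y : ∀ σ ∈ [0, L], ‖Φ_{−σ} y‖ ≤ M}` of a `C¹` cut-off field with bounded gradient is closed. [folklore] -/
theorem isClosed_lingerSet (hV : ContDiff ℝ 1 V) {K : ℝ} (hK : ∀ y, ‖fderiv ℝ V y‖ ≤ K) (L M : ℝ) :
    IsClosed {y : EuclideanSpace ℝ (Fin 3) | ∀ σ ∈ Icc (0 : ℝ) L,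
      ‖ODE.evolutionMap (fun _ : ℝ => selfSimilarTransport γ 0 V) 0 (-σ) y‖ ≤ M} := by
  have hL := C2.Kelvin.isUniformlyLipschitzOn_transport (γ := γ) hV hK
  have h : {y : EuclideanSpace ℝ (Fin 3) | ∀ σ ∈ Icc (0 : ℝ) L,
      ‖ODE.evolutionMap (fun _ : ℝ => selfSimilarTransport γ 0 V) 0 (-σ) y‖ ≤ M} =
      ⋂ σ ∈ Icc (0 : ℝ) L, {y | ‖ODE.evolutionMap (fun _ : ℝ => selfSimilarTransport γ 0 V) 0 (-σ) y‖ ≤ M} := by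
    ext y; simp only [mem_setOf_eq, mem_iInter]
  rw [h]
  exact isClosed_biInter fun σ _ =>
    isClosed_le ((hL.continuous_evolutionMap convex_univ (mem_univ _) (mem_univ _)).norm) continuous_const

/-- **CUT-OFF INDEPENDENCE**: if `V₁ = V₂` on `B̄_M` and the backward `V₁`-orbit of `y` stays in `B̄_M` during `[0, L]`, then the
backward `V₂`-orbit of `y` coincides with it on `[0, L]` (both fields `C¹` with bounded gradient; ODE uniqueness). [folklore] -/
theorem flow_neg_eq_of_agree (hV₁ : ContDiff ℝ 1 V₁) {K₁ : ℝ} (hK₁ : ∀ y, ‖fderiv ℝ V₁ y‖ ≤ K₁)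
    (hV₂ : ContDiff ℝ 1 V₂) {K₂ : ℝ} (hK₂ : ∀ y, ‖fderiv ℝ V₂ y‖ ≤ K₂) {M L : ℝ}
    (hag : ∀ w : EuclideanSpace ℝ (Fin 3), ‖w‖ ≤ M → V₁ w = V₂ w) {y : EuclideanSpace ℝ (Fin 3)}
    (hy : ∀ σ ∈ Icc (0 : ℝ) L, ‖ODE.evolutionMap (fun _ : ℝ => selfSimilarTransport γ 0 V₁) 0 (-σ) y‖ ≤ M) :
    ∀ σ ∈ Icc (0 : ℝ) L, ODE.evolutionMap (fun _ : ℝ => selfSimilarTransport γ 0 V₂) 0 (-σ) y =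
      ODE.evolutionMap (fun _ : ℝ => selfSimilarTransport γ 0 V₁) 0 (-σ) y := by
  intro σ hσ
  have hL₂ := C2.Kelvin.lipschitzWith_selfSimilarTransport (γ := γ) hV₂ hK₂
  have hLneg : LipschitzWith (Real.toNNReal (|γ| + K₂))
      (fun z => (-1 : ℝ) • selfSimilarTransport γ 0 V₂ z) :=
    LipschitzWith.of_dist_le_mul fun a b => by
      rw [neg_one_smul, neg_one_smul, dist_neg_neg]
      exact hL₂.dist_le_mul a b
  have hY₁ : ∀ t ∈ Icc (0 : ℝ) L,
      HasDerivAt (fun s => ODE.evolutionMap (fun _ : ℝ => selfSimilarTransport γ 0 V₁) 0 (-s) y)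
        ((-1 : ℝ) • selfSimilarTransport γ 0 V₂
          (ODE.evolutionMap (fun _ : ℝ => selfSimilarTransport γ 0 V₁) 0 (-t) y)) t := by
    intro t ht
    have h := C2.Kelvin.hasDerivAt_flow_neg (γ := γ) hV₁ hK₁ y t
    have hW : selfSimilarTransport γ 0 V₁ (ODE.evolutionMap (fun _ : ℝ => selfSimilarTransport γ 0 V₁) 0 (-t) y) =
        selfSimilarTransport γ 0 V₂ (ODE.evolutionMap (fun _ : ℝ => selfSimilarTransport γ 0 V₁) 0 (-t) y) := by
      simp only [selfSimilarTransport_apply, hag _ (hy t ht)]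
    rwa [hW] at h
  have hY₂ : ∀ t : ℝ,
      HasDerivAt (fun s => ODE.evolutionMap (fun _ : ℝ => selfSimilarTransport γ 0 V₂) 0 (-s) y)
        ((-1 : ℝ) • selfSimilarTransport γ 0 V₂
          (ODE.evolutionMap (fun _ : ℝ => selfSimilarTransport γ 0 V₂) 0 (-t) y)) t :=
    fun t => C2.Kelvin.hasDerivAt_flow_neg (γ := γ) hV₂ hK₂ y t
  have key := ODE_solution_unique (v := fun _ z => (-1 : ℝ) • selfSimilarTransport γ 0 V₂ z)
    (f := fun s => ODE.evolutionMap (fun _ : ℝ => selfSimilarTransport γ 0 V₁) 0 (-s) y)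
    (g := fun s => ODE.evolutionMap (fun _ : ℝ => selfSimilarTransport γ 0 V₂) 0 (-s) y)
    (a := 0) (b := L) (K := Real.toNNReal (|γ| + K₂)) (fun _ => hLneg)
    (fun t ht => (hY₁ t ht).continuousAt.continuousWithinAt)
    (fun t ht => (hY₁ t ⟨ht.1, ht.2.le⟩).hasDerivWithinAt)
    (fun t _ => (hY₂ t).continuousAt.continuousWithinAt) (fun t _ => (hY₂ t).hasDerivWithinAt)
    (by simp [ODE.evolutionMap_self])
  exact (key hσ).symm

/-- **THE INEFFECTIVE RESIDENCE CLOCK.**  `(U, P)` a `C²` self-similar Euler profile with `0 < γ < ½`, `curl U x₀ ≠ 0`.  Then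
there is a blob `B(x₀, r)` such that for EVERY `R > 0` some finite backward time `L = L(R)` suffices for at least half of the
blob's labels to have LEFT `B̄_{2R}` — for every `C¹` cut-off copy `V` of `U` (`‖DV‖ ≤ K`, `V = U` on `B(0, R_big) ⊃ B̄_{2R}`).
This is the consumer's `hclock` with `c′R^e` replaced by an unquantified `L(R)`. [folklore] -/
theorem ineffectiveClock (hprof : IsSelfSimilarEulerProfile γ 0 U P) (hγ : 0 < γ) (hγ2 : γ < 1 / 2)
    {x₀ : EuclideanSpace ℝ (Fin 3)} (hx₀ : curl U x₀ ≠ 0) :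
    ∃ r : ℝ, 0 < r ∧ ∀ R : ℝ, 0 < R → ∃ L : ℝ, 0 ≤ L ∧
      ∀ (V : EuclideanSpace ℝ (Fin 3) → EuclideanSpace ℝ (Fin 3)) (K Rbig : ℝ), ContDiff ℝ 1 V →
        (∀ y, ‖fderiv ℝ V y‖ ≤ K) → 2 * R < Rbig → (∀ w ∈ ball (0 : EuclideanSpace ℝ (Fin 3)) Rbig, V w = U w) →
        (volume (ball x₀ r ∩ {y | ∀ σ ∈ Icc (0 : ℝ) L,
          ‖ODE.evolutionMap (fun _ : ℝ => selfSimilarTransport γ 0 V) 0 (-σ) y‖ ≤ 2 * R})).toReal ≤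
          (volume (ball x₀ r)).toReal / 2 := by
  have hU2 : ContDiff ℝ 2 U := hprof.contDiff_velocity
  have hU1 : ContDiff ℝ 1 U := hU2.of_le (by norm_num)
  -- the blob: a ball inside the open vortical set
  have hopen : IsOpen {x : EuclideanSpace ℝ (Fin 3) | curl U x ≠ 0} :=
    isOpen_ne_fun (continuous_curl hU1) continuous_const
  obtain ⟨r, hr, hsub⟩ := Metric.isOpen_iff.1 hopen x₀ hx₀
  refine ⟨r, hr, fun R hR => ?_⟩
  -- the canonical cut-off, equal to `U` on `ball 0 (2R + 1)`
  obtain ⟨V₀, hV₀, -, -, ⟨K₀, hK₀⟩, hagree₀⟩ := Loc.exists_cutoff_local hU2 (R := 2 * R + 1) (by linarith)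
  have hV₀1 : ContDiff ℝ 1 V₀ := hV₀.of_le (by norm_num)
  -- the decreasing family of linger sets of the canonical cut-off
  set s : ℕ → Set (EuclideanSpace ℝ (Fin 3)) := fun n => ball x₀ r ∩ {y | ∀ σ ∈ Icc (0 : ℝ) (n : ℝ),
      ‖ODE.evolutionMap (fun _ : ℝ => selfSimilarTransport γ 0 V₀) 0 (-σ) y‖ ≤ 2 * R} with hs
  have hsm : ∀ n, NullMeasurableSet (s n) volume := fun n =>
    (measurableSet_ball.inter (isClosed_lingerSet (γ := γ) hV₀1 hK₀ _ _).measurableSet).nullMeasurableSet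
  have hanti : Antitone s := by
    intro m n hmn y hy
    exact ⟨hy.1, fun σ hσ => hy.2 σ ⟨hσ.1, hσ.2.trans (by exact_mod_cast hmn)⟩⟩
  have hfin : ∃ n, volume (s n) ≠ ∞ :=
    ⟨0, ((measure_mono inter_subset_left).trans_lt measure_ball_lt_top).ne⟩
  -- the intersection lies in the NULL set of vortical points with a confined backward orbit (`N = 2R`)
  have hnull : volume (⋂ n, s n) = 0 := by
    refine measure_mono_null ?_ (Loc.volume_vortical_confined_eq_zero hprof hγ hγ2 (N := 2 * R) (by linarith))
    intro x hx
    rw [mem_iInter] at hx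
    have hconf : ∀ t : ℝ, 0 ≤ t →
        ‖ODE.evolutionMap (fun _ : ℝ => selfSimilarTransport γ 0 V₀) 0 (-t) x‖ ≤ 2 * R := by
      intro t ht
      obtain ⟨n, hn⟩ := exists_nat_ge t
      exact (hx n).2 t ⟨ht, hn⟩
    refine ⟨hsub (hx 0).1, fun t => ODE.evolutionMap (fun _ : ℝ => selfSimilarTransport γ 0 V₀) 0 (-t) x,
      by simp [ODE.evolutionMap_self], fun t ht => ?_, hconf⟩
    have h := C2.Kelvin.hasDerivAt_flow_neg (γ := γ) hV₀1 hK₀ x t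
    have hW : selfSimilarTransport γ 0 V₀ (ODE.evolutionMap (fun _ : ℝ => selfSimilarTransport γ 0 V₀) 0 (-t) x) =
        selfSimilarTransport γ 0 U (ODE.evolutionMap (fun _ : ℝ => selfSimilarTransport γ 0 V₀) 0 (-t) x) := by
      have hmem : ODE.evolutionMap (fun _ : ℝ => selfSimilarTransport γ 0 V₀) 0 (-t) x ∈
          ball (0 : EuclideanSpace ℝ (Fin 3)) (2 * R + 1) := by
        rw [mem_ball, dist_zero_right]; linarith [hconf t ht]
      simp only [selfSimilarTransport_apply, hagree₀ _ hmem]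
    rwa [hW] at h
  -- measure continuity from above
  have htend : Tendsto (volume ∘ s) atTop (𝓝 0) := by
    have h := tendsto_measure_iInter_atTop hsm hanti hfin
    rwa [hnull] at h
  have hballpos : 0 < volume (ball x₀ r) := measure_ball_pos volume x₀ hr
  have hhalf : 0 < volume (ball x₀ r) / 2 := ENNReal.div_pos_iff.2 ⟨hballpos.ne', by simp⟩
  obtain ⟨n, hn⟩ := ENNReal.tendsto_atTop_zero.1 htend (volume (ball x₀ r) / 2) hhalf
  refine ⟨(n : ℝ), n.cast_nonneg, fun V K Rbig hV hK hRbig hagree => ?_⟩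
  -- cut-off independence: the `V`-linger set is contained in the `V₀`-linger set
  have hag : ∀ w : EuclideanSpace ℝ (Fin 3), ‖w‖ ≤ 2 * R → V w = V₀ w := by
    intro w hw
    rw [hagree w (by rw [mem_ball, dist_zero_right]; linarith),
      hagree₀ w (by rw [mem_ball, dist_zero_right]; linarith)]
  have hsubset : ball x₀ r ∩ {y | ∀ σ ∈ Icc (0 : ℝ) (n : ℝ),
      ‖ODE.evolutionMap (fun _ : ℝ => selfSimilarTransport γ 0 V) 0 (-σ) y‖ ≤ 2 * R} ⊆ s n := by
    rintro y ⟨hy, hlin⟩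
    refine ⟨hy, fun σ hσ => ?_⟩
    rw [flow_neg_eq_of_agree (γ := γ) hV hK hV₀1 hK₀ hag hlin σ hσ]
    exact hlin σ hσ
  have hle : volume (ball x₀ r ∩ {y | ∀ σ ∈ Icc (0 : ℝ) (n : ℝ),
      ‖ODE.evolutionMap (fun _ : ℝ => selfSimilarTransport γ 0 V) 0 (-σ) y‖ ≤ 2 * R}) ≤
      volume (ball x₀ r) / 2 := (measure_mono hsubset).trans (hn n le_rfl)
  have hne : volume (ball x₀ r) / 2 ≠ ∞ := ENNReal.div_ne_top measure_ball_lt_top.ne (by simp)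
  calc (volume (ball x₀ r ∩ {y | ∀ σ ∈ Icc (0 : ℝ) (n : ℝ),
          ‖ODE.evolutionMap (fun _ : ℝ => selfSimilarTransport γ 0 V) 0 (-σ) y‖ ≤ 2 * R})).toReal
        ≤ (volume (ball x₀ r) / 2).toReal := ENNReal.toReal_mono hne hle
    _ = (volume (ball x₀ r)).toReal / 2 := by rw [ENNReal.toReal_div]; norm_num

end Summit.NavierStokesRegularity.NavierStokesRegularity.Theorems.PowerGaugeEulerLiouville.NeedleClock
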